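import Literature.MathematicalPhysics.QuantumFieldTheory.Balaban1983to89.B9Thm313WholeGGBlocksRegularT
import Literature.MathematicalPhysics.QuantumFieldTheory.Balaban1983to89.B9StateAprioriL1

/-!
# `Balaban1983to89.B9Thm313WholeG1PairMembersRegular` — T. Bałaban, *Propagators for lattice gauge theories in a background field*, Commun. Math. Phys. **99** (1985) 389–434
# [`Balaban1985BackgroundPropagators`], Theorem 3.12 pp. 421–423 + (3.44)–(3.45) p. 398: THE (3.44)∕(3.45)-TYPE PAIR MEMBERS OF G₁ = 𝒢(U) OUT OF THE REGULAR STATE —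
# `∇_{U,ν}G₁∇\*_{U,μ}` from the Hölder input class INTO the block sup class and INTO the β-probe readings, and the right entry `G₁∇\*_{U,μ}` INTO the state and INTO 𝔠⁽¹⁾ —
# one member, one configuration: the row-21 S-leaf's INTERNAL `hGI1 ∕ h2A ∕ hGop ∕ hGop45` (`…RegularT.GG_inputs_of_stateST`, `…CompletePairMBCZcUSXC`) LIFTED OUT as a theorem

[4] = T. Bałaban, *Propagators and renormalization transformations for lattice gauge theories. II*, Commun. Math. Phys. **96** (1984) 223–250 [`Balaban1984PropagatorsII`].
statement-level skeleton of published theorems with citation tags; proofs where landed; nothing here is a claim about the Yang–Mills mass gap.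

THE PRINT.  Thm 3.12 p. 421: *"the operator 𝒢(U) satisfies Theorems 3.3, 3.10, 3.11"* — by the first resolvent form `𝒢 = G₀ + G₀(Δ′_π + Δ⁽²⁾_π)𝒢` over the regular state
(p. 423: *"the perturbation … applied to regular functions only"*), i.e. the (3.44)∕(3.45) members of G₁ = 𝒢 are those of G₀ (Theorem 3.3, `Thm33G0Dir.h44m ∕ h45m`) plus the
state correction; Thm 3.13 p. 426 then *"reduce[s] properties of 𝔊 to the corresponding properties of … G₁"*.

WHY THIS FILE (cell `pub-ymgap`, node N06, bundle F7 rows 20–21, seat dag-n06-l g32; programme P-HRGDD leg (A), dag-lead g30 WORDS 222 (4) «leg (A) → n06-l»).  The supply of the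
certificate's displayed letter `hrgdd13` (RD\*G₁∇\*_μ, lossy species since face v1.7 ✓p757146) runs `R∘D\*∘G₁∘∇\*_μ = Σ_ν R∘J_νᵀ∘[∇_νG₁∇\*_μ]`; the bracket's sup and β-probe
members are DERIVED INSIDE the row-21 leaf per member (`hGop ∕ hGop45` of `…RegularT.GG_inputs_of_stateST`, from `Thm33G0Dir.h44m ∕ h45m` and the 𝔖₁ state layer by
`B9Thm312WholeMembersRegular.input44∕45_of_stateS`, the right entry `G₁∇\*_μ` by `hasMaj_right_of_stepS` with the ℓ¹ a-priori bound of `B9StateAprioriL1`) but never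
exported.  THIS FILE lifts them out, one member, one configuration, with EXACTLY the leaf's per-member inputs (the 𝔖₁ state tuple's members `hS1 hPDds hDd1 hXd1 hRd1 hdom1`,
`hdomX`, `Thm33G0Dir`, `Identities`, `RowSum`, the smallness `𝔖₁.κ·θ·c ≦ ½`), so that the certificate instantiates it with the very terms it passes to the rows-20–21 face:
★★ `g1Pair_members_of_stateS` — (i) `G₁∇\*_μ : bHX ε → 𝔖₁` at `2·A_I ε`, rate `ρ + σ`; (ii) `G₁∇\*_μ : bHX ε → 𝔠⁽¹⁾` at `𝔖₁.κ·C_{R₁}·2A_I ε·c`, rate ρ; (iii) `∇_νG₁∇\*_μ :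
bHX ε → ofBlocks` at `Bi ε + 𝔖₁.κ·θ′·2A_I ε·c`, rate `ρ − σ` (`0 < ε ≦ 1`); (iv) `Φ^X_β∇_νG₁∇\*_μ : bHX (β+ε) → 𝔠_P^{(β)}-probe blocks` at `(Bi2 ε β + 𝔖₁.κ·θ_H β·2A_I(β+ε)·c)
·(Lʲη)^{−β}`, rate `ρ − σ` (`0 < ε ≦ 1`, `0 ≦ β < 1`).  Consumers: leg (B) (dag-n06-c: `J_νᵀ` and the closure INTO the transported class from (iii)+(iv)), leg (C)
(`B9SmoothHolderClassPProducersR`), leg (D) (assembly).  Source exponents above 1 (the (3.45) chain reads `bHX (β+ε)`): (iii) is Theorem 3.3's range `0 < ε ≦ 1` verbatim;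
a consumer needing the sup member above 1 reads it at exponent 1 through the source class's monotonicity in the exponent (not typed here).
HONEST SCOPE.  Re-packaging of landed per-member algebra; Theorem 3.3's members, the state layer and the identities are HYPOTHESES of printed species — nothing of
[B9]∕[4] asserted; no pin, no certificate edit; COUNT-NEUTRAL; N06 NOT discharged; nothing continuum ∕ OS positivity ∕ mass gap ∕ Clay.  NEW file.
-/

namespace Literature.MathematicalPhysics.QuantumFieldTheory.Balaban1983to89.B9Thm313WholeG1PairMembersRegular

open Finset B6RandomWalk B6RandomWalkHom B9Thm34Ext B11SectG B9SectDSup B9SectDL2Decay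
open B9Thm312Whole B9Thm312WholeLeaf B9Thm312WholeClasses B9RWSums343Holder B9Thm312WholeDir
open B9Thm312WholeStepRegular B9Thm312WholeMembersRegular B9StateAprioriL1

noncomputable section

section OneMember

variable {g : B9.Geometry} {B : B9.Backgrounds} {X Y Z W PX PY P : Type}
variable [Fintype X] [Fintype Y] [Fintype Z] [Fintype W] [Fintype PX] [Fintype PY] [Fintype P] [Fintype g.Site] [DecidableEq g.Site]
variable {R₀ : ℝ} {H₀ : Prop}

omit [Fintype Y] [Fintype PY] [Fintype P] [DecidableEq g.Site] in
/-- ★★ **THE (3.44)∕(3.45) PAIR MEMBERS OF G₁ AND ITS RIGHT ENTRY `G₁∇\*_{U,μ}`, OUT OF THE REGULAR STATE** (one member, one configuration): from Theorem 3.3's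
`h44m ∕ h45m` for G₀ (`Thm33G0Dir`), the 𝔖₁ state layer (`StepS`, the right entry `G₀∇\*_μ : bHX ε → 𝔖₁` at `A_I ε`, the fields `∇_νG₀T : 𝔖₁ → 𝔠⁽⁰⁾`, `Φ^X_β∇_νG₀T :
𝔖₁ → 𝔠_P^{(β)}`, the reading `𝔖₁ → 𝔠^{(−1)}`, the ℓ¹ domination of 𝔖₁), the ℓ¹ control of the input classes, the identities (first resolvent form) and the smallness
`𝔖₁.κ·θ·c ≦ ½`: (i) `G₁∇\*_μ : bHX ε → 𝔖₁` (size `2A_I ε`, rate `ρ + σ`); (ii) `G₁∇\*_μ : bHX ε → 𝔠⁽¹⁾` (size `𝔖₁.κ·C_{R₁}·(2A_I ε)·c`, rate ρ); (iii) `∇_{q.1}G₁∇\*_{q.2} :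
bHX ε → ofBlocks` (size `Bi ε + 𝔖₁.κ·θ′·(2A_I ε)·c`, rate `ρ − σ`, `0 < ε ≦ 1`); (iv) `Φ^X_β∇_{q.1}G₁∇\*_{q.2} : bHX (β+ε) → 𝔠_P-blocks` (size `(Bi2 ε β + 𝔖₁.κ·θ_H β·
(2A_I (β+ε))·c)·(Lʲη)^{−β}`, rate `ρ − σ`, `0 < ε ≦ 1`, `0 ≦ β < 1`).  Rates: `σ ≦ ρ ≦ δ₀`, `ρ + σ ≦ δ_P`, `ρ + 2σ ≦ δ_K`.
[cite: Balaban1985BackgroundPropagators, Thm 3.12 pp.421–423 + Thm 3.3 (3.44)–(3.45) p.398 + Thm 3.13 p.426; Balaban1984PropagatorsII, (2.52)–(2.56) pp.232–233 + Lemma 2.1 (2.61) p.234] -/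
theorem g1Pair_members_of_stateS (hG : GeoOK g) (𝔭 : HolderProbes g B X Y PX PY) {𝔬 : Ops g B X Y Z W} {U : B.Cfg}
    {Dd Dds : B.Cfg → P → Module.End ℝ (X → ℝ)} {bHX : ℝ → BlockNorm (toB6 g R₀ H₀) (X → ℝ)} (𝔖₁ : BlockNorm (toB6 g R₀ H₀) (X → ℝ))
    {θ θ' B₀ CR₁ Λ₁ δ₀ δK δP ρ σ c : ℝ} {θH AI Bh Bi : ℝ → ℝ} {Bi2 : ℝ → ℝ → ℝ}
    (hrow : RowSum (toB6 g R₀ H₀) σ c) (hθ : 0 ≤ θ) (hθ' : 0 ≤ θ') (hθH : ∀ β, 0 ≤ β → β < 1 → 0 ≤ θH β)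
    (hAI : ∀ ε, 0 < ε → 0 ≤ AI ε) (hCR₁ : 0 ≤ CR₁) (hBi : ∀ ε, 0 < ε → ε ≤ 1 → 0 ≤ Bi ε)
    (hBi2 : ∀ ε β, 0 < ε → ε ≤ 1 → 0 ≤ β → β < 1 → 0 ≤ Bi2 ε β)
    (hσρ : σ ≤ ρ) (hσ : 0 ≤ σ) (hρS : ρ ≤ δ₀) (hρP : ρ + σ ≤ δP) (hρK : ρ + 2 * σ ≤ δK) (hq1 : 𝔖₁.κ * θ * c ≤ 1 / 2)
    (hH0 : Thm33G0Dir 𝔬 𝔭 Dd Dds R₀ H₀ bHX B₀ Bh Bi Bi2 δ₀ U) (hI : Identities 𝔬 U) (hS1 : StepS 𝔬 𝔖₁ θ δK U)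
    (hPDds : ∀ (μ : P) (ε : ℝ), 0 < ε → HasMaj (bHX ε) 𝔖₁ (𝔬.G0 U ∘ₗ Dds U μ) (fun a b => AI ε * Real.exp (-(δP * g.dist a b))))
    (hDd1 : ∀ ν : P, HasMaj 𝔖₁ (cNormR R₀ H₀ 𝔬.blk hG.lenle 0) (Dd U ν ∘ₗ 𝔬.G0 U ∘ₗ (𝔬.Tpi U + 𝔬.T2 U))
      (fun a b => θ' * Real.exp (-(δK * g.dist a b))))
    (hXd1 : ∀ (ν : P) (β : ℝ), 0 ≤ β → β < 1 → HasMaj 𝔖₁ (cNormR R₀ H₀ 𝔭.blkPX hG.lenle β)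
      ((𝔭.ΦX U β ∘ₗ Dd U ν ∘ₗ 𝔬.G0 U) ∘ₗ (𝔬.Tpi U + 𝔬.T2 U)) (fun a b => θH β * Real.exp (-(δK * g.dist a b))))
    (hRd1 : HasMaj 𝔖₁ (cNormR R₀ H₀ 𝔬.blk hG.lenle (-1)) LinearMap.id (fun a b => CR₁ * Real.exp (-(δP * g.dist a b))))
    (hΛ₁ : 0 ≤ Λ₁) (hdom1 : ∀ (y : g.Site) (F : X → ℝ), 𝔖₁.loc y F ≤ Λ₁ * ∑ x : X, |F x|)
    (hdomX : ∀ ε : ℝ, 0 < ε → ∃ ΛX : ℝ, 0 ≤ ΛX ∧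
      ∀ (y : g.Site) (μ : X → ℝ), (bHX ε).IsLoc y μ → ∑ q : X, |μ q| ≤ ΛX * (bHX ε).loc y μ) :
    (∀ (μ : P) (ε : ℝ), 0 < ε → HasMaj (bHX ε) 𝔖₁ (𝔬.G1 U ∘ₗ Dds U μ) (fun a b => 2 * AI ε * Real.exp (-((ρ + σ) * g.dist a b)))) ∧
    (∀ (μ : P) (ε : ℝ), 0 < ε → HasMaj (bHX ε) (cNorm R₀ H₀ 𝔬.blk hG.lenle 1) (𝔬.G1 U ∘ₗ Dds U μ)
      (fun a b => 𝔖₁.κ * CR₁ * (2 * AI ε) * c * Real.exp (-(ρ * g.dist a b)))) ∧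
    (∀ (q : P × P) (ε : ℝ), 0 < ε → ε ≤ 1 → HasMaj (bHX ε) (BlockNorm.ofBlocks (toB6 g R₀ H₀) 𝔬.blk)
      (Dd U q.1 ∘ₗ (𝔬.G1 U ∘ₗ Dds U q.2)) (fun a b => (Bi ε + 𝔖₁.κ * θ' * (2 * AI ε) * c) * Real.exp (-((ρ - σ) * g.dist a b)))) ∧
    (∀ (q : P × P) (ε β : ℝ), 0 < ε → ε ≤ 1 → 0 ≤ β → β < 1 →
      HasMaj (bHX (β + ε)) (cNormR R₀ H₀ 𝔭.blkPX hG.lenle β) ((𝔭.ΦX U β ∘ₗ Dd U q.1) ∘ₗ (𝔬.G1 U ∘ₗ Dds U q.2))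
        (fun a b => (Bi2 ε β + 𝔖₁.κ * θH β * (2 * AI (β + ε)) * c) * Real.exp (-((ρ - σ) * g.dist a b)))) := by
  have hfix1 := fix_of_inverses hI.invG0' hI.invG1
  have hq1lt : 𝔖₁.κ * θ * c < 1 := by linarith
  have hinv1 : (1 - 𝔖₁.κ * θ * c)⁻¹ ≤ 2 := inv_one_sub_le_two hq1
  have hAI2 : ∀ ε, 0 < ε → 0 ≤ 2 * AI ε := fun ε hε => mul_nonneg zero_le_two (hAI ε hε)
  -- rates
  have hρ0 : 0 ≤ ρ := hσ.trans hσρ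
  have hρ₁0 : 0 ≤ ρ + σ := add_nonneg hρ0 hσ
  have hρ₁K : ρ + σ + σ ≤ δK := by linarith
  have hρρ₁ : ρ ≤ ρ + σ := by linarith
  have hρm0 : 0 ≤ ρ - σ := by linarith
  have hρm₀ : ρ - σ ≤ δ₀ := by linarith
  have hρm₁ : ρ - σ ≤ ρ + σ := by linarith
  have hρmK : ρ - σ + σ ≤ δK := by linarith
  -- the kernel weakening helper
  have wk : ∀ {F₁ F₂ : Type} [AddCommGroup F₁] [Module ℝ F₁] [AddCommGroup F₂] [Module ℝ F₂]
      {b₁ : BlockNorm (toB6 g R₀ H₀) F₁} {b₂ : BlockNorm (toB6 g R₀ H₀) F₂} {T : F₁ →ₗ[ℝ] F₂} {C C' r₁ : ℝ},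
      C ≤ C' → HasMaj b₁ b₂ T (fun a b => C * Real.exp (-(r₁ * g.dist a b))) → HasMaj b₁ b₂ T (fun a b => C' * Real.exp (-(r₁ * g.dist a b))) :=
    fun hCC h => h.mono fun a b => mul_le_mul_of_nonneg_right hCC (Real.exp_nonneg _)
  -- (i) the right entry G₁∇*_μ INTO the state (first resolvent form over 𝔖₁, ℓ¹ a-priori bound)
  have hGI1 : ∀ (μ : P) (ε : ℝ), 0 < ε → HasMaj (bHX ε) 𝔖₁ (𝔬.G1 U ∘ₗ Dds U μ)
      (fun a b => 2 * AI ε * Real.exp (-((ρ + σ) * g.dist a b))) := by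
    intro μ ε hε
    classical
    obtain ⟨ΛX, hΛX, hl1X⟩ := hdomX ε hε
    obtain ⟨M₀, hM₀, hap⟩ := exists_hasMaj_const_of_l1_src hΛX hl1X hΛ₁ hdom1 (𝔬.G1 U ∘ₗ Dds U μ)
    have h := hasMaj_right_of_stepS hG hrow hθ (hAI ε hε) hM₀ hρ₁0 hρP hρ₁K hS1.step1 (hPDds μ ε hε) hfix1 hap hq1lt
    exact wk (by calc AI ε * (1 - 𝔖₁.κ * θ * c)⁻¹ ≤ AI ε * 2 := mul_le_mul_of_nonneg_left hinv1 (hAI ε hε)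
        _ = 2 * AI ε := by ring) h
  -- (ii) read in the sup class 𝔠⁽¹⁾
  have hRd1n : HasMaj 𝔖₁ (cNorm R₀ H₀ 𝔬.blk hG.lenle 1) LinearMap.id (fun a b => CR₁ * Real.exp (-(δP * g.dist a b))) := by
    intro y' μ hμ y
    have hb := hRd1 y' μ hμ y
    rwa [show (-1 : ℝ) = -((1 : ℕ) : ℝ) by norm_num, cNormR_loc_neg_natCast hG] at hb
  have h2A : ∀ (μ : P) (ε : ℝ), 0 < ε → HasMaj (bHX ε) (cNorm R₀ H₀ 𝔬.blk hG.lenle 1) (𝔬.G1 U ∘ₗ Dds U μ)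
      (fun a b => 𝔖₁.κ * CR₁ * (2 * AI ε) * c * Real.exp (-(ρ * g.dist a b))) := by
    intro μ ε hε
    have h := hasMaj_read_of_state hG hrow (hAI2 ε hε) hCR₁ hρ0 hρρ₁ hρP (hGI1 μ ε hε) hRd1n
    rw [LinearMap.id_comp] at h
    exact h
  refine ⟨hGI1, h2A, ?_, ?_⟩
  · -- (iii) the (3.44) pieces per pair, at the rate ρ − σ
    intro q ε hε0 hε1
    exact input44_of_stateS hG hrow hθ' (hBi ε hε0 hε1) (hAI2 ε hε0) hρm0 hρm₀ hρm₁ hρmK (hH0.h44m q ε hε0 hε1) (hDd1 q.1)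
      (hGI1 q.2 ε hε0) hfix1
  · -- (iv) the (3.45) pieces per pair, at the rate ρ − σ
    intro q ε β hε0 hε1 hb0 hb1
    have hε' : 0 < β + ε := by linarith
    have hP : HasMaj 𝔖₁ (cNormR R₀ H₀ 𝔭.blkPX hG.lenle β) ((𝔭.ΦX U β ∘ₗ Dd U q.1) ∘ₗ 𝔬.G0 U ∘ₗ (𝔬.Tpi U + 𝔬.T2 U))
        (fun a b => θH β * Real.exp (-(δK * g.dist a b))) := (hXd1 q.1 β hb0 hb1).congr fun μ => rfl
    have h45' : HasMaj (bHX (β + ε)) (BlockNorm.ofBlocks (toB6 g R₀ H₀) 𝔭.blkPX) ((𝔭.ΦX U β ∘ₗ Dd U q.1) ∘ₗ (𝔬.G0 U ∘ₗ Dds U q.2))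
        (fun (a b : g.Site) => Bi2 ε β * g.len a ^ (-β) * Real.exp (-(δ₀ * g.dist a b))) := (hH0.h45m q ε β hε0 hε1 hb0 hb1).congr fun μ => rfl
    have h := input45_of_stateS hG hrow (hθH β hb0 hb1) (hBi2 ε β hε0 hε1 hb0 hb1) (hAI2 (β + ε) hε') hρm0 hρm₀ hρm₁ hρmK
      h45' hP (hGI1 q.2 (β + ε) hε') hfix1
    exact hasMaj_weight_out hG (h.mono fun a b => le_of_eq (by ring))

end OneMember

end

end Literature.MathematicalPhysics.QuantumFieldTheory.Balaban1983to89.B9Thm313WholeG1PairMembersRegular
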